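import Literature.AlgebraicGeometry.Modules.PullbackAffineChart
import Literature.AlgebraicGeometry.Modules.AffineLocalizingClosure
import Literature.AlgebraicGeometry.Modules.IsoOfSectionsOnBasis
import Literature.AlgebraicGeometry.KTheory.PullbackVectorBundle
import Mathlib.AlgebraicGeometry.Morphisms.Flat
import Mathlib.RingTheory.Flat.Basic
import HarnessLib

/-!
# Flat pull-back is exact on quasi-coherent modules: `f` flat ⇒ `f^*` preserves monomorphisms

Görtz–Wedhorn, *Algebraic Geometry I* (2nd ed.), §(7.18), the statement after Remark 7.39 with
(7.18.1): "if `𝓕` is flat over `Y`, then the functor `𝒢 ↦ f^*𝒢 ⊗_{𝒪_X} 𝓕` is exact" — for `𝓕 = 𝒪_X`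
(Definition 7.38 (3): `f` is flat iff `𝒪_X` is flat over `Y`): **for a FLAT morphism of schemes
`f : X → Y` the inverse-image functor `f^*` is EXACT**; here on quasi-coherent `𝒪_Y`-modules
(Hartshorne III §9, p. 254, for the definition of flatness via stalks). Since `f^*`
(Mathlib's `Scheme.Modules.pullback f`, an abstract left adjoint) is right exact for every `f`, the
content is: **`f^*` carries monomorphisms `ι : M' ↪ M` of quasi-coherent modules to monomorphisms.**

We prove this for Mathlib's `AlgebraicGeometry.Flat f` and the tree's AFFINE-LOCALIZING modules
(`Modules/AffineLocalizing`; quasi-coherent ⇒ affine-localizing, `IsAffineLocalizing.of_isQuasicoherent`),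
by the affine-local proof on the charts of `Modules/PullbackAffineChart` (Görtz–Wedhorn I
Prop. 7.24 (2), Remark 7.39): for affine opens `U ⊆ X`, `V ⊆ Y` with `f(U) ⊆ V`, the sections `Γ(U, f^*M)` are
`Γ(U, 𝒪_X) ⊗_{Γ(V, 𝒪_Y)} Γ(V, M)` (`chartSectionsEquiv`), NATURALLY in `M`
(`app_pullback_map_chartSectionsEquiv`: under the chart, `(f^*ι)|_U` is `𝟙 ⊗ ι|_V`); `Γ(U, 𝒪_X)` is a
flat `Γ(V, 𝒪_Y)`-algebra (Remark 7.39; `Flat` is the affine-local property of `RingHom.Flat`, Mathlib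
`HasRingHomProperty.appLE`), so `𝟙 ⊗ ι|_V` is injective (`Module.Flat.lTensor_preserves_injective_linearMap`);
such `U` form a basis of `X`, and a morphism of `𝒪_X`-modules injective on the sections over a basis
is a monomorphism (`Modules/IsoOfSectionsOnBasis`; affine opens form a basis, Prop. 3.2 (2)).

* `restrictTopMap`, `chartTensorMap` — the maps `Γ(V, M') → Γ(V, M)` and
  `Γ(U) ⊗ Γ(V, M') → Γ(U) ⊗ Γ(V, M)` induced by `ι` on the chart modules;
* `pullback_map_app_unitSectionLE` — `(f^*ι)(η(m)|_U) = η(ι m)|_U` (naturality of the unit);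
* `app_pullback_map_chartSectionsEquiv` — the chart square;
* `chartTensorMap_injective` — flatness;
* **`pullback_map_app_injective_of_flat`**, **`mono_pullback_map_of_flat`** — the theorem;
* **`shortExact_map_pullback_of_flat`** — `f^*` carries short exact sequences
  `0 → M' → M → M'' → 0` with `M'`, `M` affine-localizing to short exact sequences (right exactness is
  the tree's `KTheory.exact_map_pullback_and_epi`).

Everything is proved; no named facts. Written for the cell `pub-hodge-ring2` (route №4, crux
stmt-HodgeConjecture-26512, node «IsogenyDerivedAdjointPair», block (Q1c) «`g` flat ⇒ `g^*` exact on
QCoh»; seat core-w2). Not here (absent from Mathlib and the tree, not needed by that block): exactness of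
`f^*` on ALL `𝒪_Y`-modules, which is the stalk formula `(f^*M)_x = M_{f(x)} ⊗_{𝒪_{Y,f(x)}} 𝒪_{X,x}`.

## References

* U. Görtz, T. Wedhorn, *Algebraic Geometry I: Schemes*, 2nd ed., Springer Spektrum (2020): Prop. 3.2 (2),
  Prop. 7.24 (2), Def. 7.38, Rem. 7.39 and (7.18.1) — read in the held copy
  `book:gortz2020-algebraic-geometry-i-schemes-2nd-ed` (text chunks p0088, p0231, p0240–p0241).
  [GortzWedhorn2020]
* R. Hartshorne, *Algebraic Geometry*, GTM 52 (1977), III §9 p. 254 (flatness), II Prop. 5.2 (e)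
  (p. 110: `f^*(M~) = (M ⊗_A B)~`). [Hartshorne1977]
-/

noncomputable section

-- `TopCat.Presheaf`/`Scheme.Modules` are not reducible (as in Mathlib's `AlgebraicGeometry/Modules`).
set_option backward.isDefEq.respectTransparency false

open CategoryTheory AlgebraicGeometry Limits TopologicalSpace Opposite TensorProduct
open scoped ChangeOfRings

universe u

namespace Literature.AlgebraicGeometry.Modules

open Literature.AlgebraicGeometry.Motives Literature.AlgebraicGeometry.KTheory

variable {X Y : Scheme.{u}} (f : X ⟶ Y)

/-! ### The maps induced by `ι : M' → M` on the chart modules -/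

section Chart

variable {M' M : Y.Modules} (ι : M' ⟶ M) {V : Y.Opens} (hV : IsAffineOpen V)
  {U : X.Opens} (hU : IsAffineOpen U) (i : U ≤ f ⁻¹ᵁ V)

/-- The `Γ(V, 𝒪_Y)`-linear map `Γ(V, M') → Γ(V, M)` of sections of `ι` on the chart modules
`restrictTop` (functoriality of `M ↦ M|_{Spec Γ(V)}` and of Mathlib's `modulesSpecToSheaf`). [folklore] -/
def restrictTopMap : restrictTop M' hV ⟶ restrictTop M hV :=
  (modulesSpecToSheaf.map ((Scheme.Modules.restrictFunctor hV.fromSpec).map ι)).1.app (op ⊤)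

/-- `restrictTopMap ι` is `ι` on the sections over `Spec Γ(V) → V`. [folklore] -/
private theorem restrictTopMap_apply' (x : restrictTop M' hV) :
    restrictTopMap ι hV x = ι.app (hV.fromSpec ''ᵁ ⊤) x :=
  rfl

/-- `restrictTopMap ι` sends (the transport of) `m ∈ Γ(V, M')` to (the transport of) `ι m` (the chart
modules are functorial in `M`). [cite: GortzWedhorn2020, Prop. 7.24 (2)] -/
theorem restrictTopMap_apply (m : Γ(M', V)) :
    restrictTopMap ι hV (appTopRestrictFromSpecEquiv M' hV m) =
      appTopRestrictFromSpecEquiv M hV (ι.app V m) := by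
  rw [restrictTopMap_apply']
  exact Scheme.Modules.Hom.app_map_apply ι (eqToHom (fromSpec_image_top hV)) m

/-- `restrictTopMap ι` is injective for a monomorphism `ι`. [folklore] -/
private theorem restrictTopMap_injective [Mono ι] : Function.Injective (restrictTopMap ι hV) := by
  intro x y h
  rw [restrictTopMap_apply', restrictTopMap_apply'] at h
  exact app_injective_of_mono ι _ h

/-- The map `Γ(U) ⊗_{Γ(V)} Γ(V, M') → Γ(U) ⊗_{Γ(V)} Γ(V, M)`, `c ⊗ m ↦ c ⊗ ι m`, of the chart
modules `chartTensor` (Mathlib's extension of scalars applied to `restrictTopMap ι`). [folklore] -/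
abbrev chartTensorMap : chartTensor f M' hV i ⟶ chartTensor f M hV i :=
  (ModuleCat.extendScalars.{u, u, u} (chartHom f i).hom).map (restrictTopMap ι hV)

/-- `chartTensorMap` on pure tensors. [folklore] -/
private theorem chartTensorMap_tmul (c : Γ(X, U)) (p : restrictTop M' hV) :
    chartTensorMap f ι hV i (c ⊗ₜ[Γ(Y, V), (chartHom f i).hom] p) =
      c ⊗ₜ[Γ(Y, V), (chartHom f i).hom] restrictTopMap ι hV p :=
  rfl

/-- **Naturality of the pulled-back sections**: `(f^*ι)(η(m)|_U) = η(ι m)|_U` (naturality of the unit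
of `f^* ⊣ f_*`). [cite: Hartshorne1977, II §5 p. 110 (`f^* ⊣ f_*`)] -/
theorem pullback_map_app_unitSectionLE (m : Γ(M', V)) :
    ((Scheme.Modules.pullback f).map ι).app U (unitSectionLE f M' i m) =
      unitSectionLE f M i (ι.app V m) := by
  rw [unitSectionLE, unitSectionLE, Scheme.Modules.Hom.app_map_apply, pullback_map_app_unitSection]

/-- `chartSectionsEquiv (c ⊗ m) = c · η(m)|_U`. [cite: GortzWedhorn2020, Prop. 7.24 (2) (proof)] -/
theorem chartSectionsEquiv_tmul (hM : IsAffineLocalizing M) (c : Γ(X, U)) (m : Γ(M, V)) :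
    chartSectionsEquiv f M hV hU i hM (c ⊗ₜ[Γ(Y, V), (chartHom f i).hom] (appTopRestrictFromSpecEquiv M hV m)) =
      c • unitSectionLE f M i m := by
  have h1 : (c ⊗ₜ[Γ(Y, V), (chartHom f i).hom] (appTopRestrictFromSpecEquiv M hV m) : chartTensor f M hV i) =
      c • ((1 : Γ(X, U)) ⊗ₜ[Γ(Y, V), (chartHom f i).hom] (appTopRestrictFromSpecEquiv M hV m) :
        chartTensor f M hV i) := by
    refine ((ModuleCat.ExtendScalars.smul_tmul (M := restrictTop M hV) (chartHom f i).hom c 1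
      (appTopRestrictFromSpecEquiv M hV m)).trans ?_).symm
    rw [mul_one]
  rw [h1, chartSectionsEquiv_smul, chartSectionsEquiv_one_tmul]

/-- **The chart square**: under `chartSectionsEquiv : Γ(U) ⊗_{Γ(V)} Γ(V, –) ≃ Γ(U, f^*–)` the map
`(f^*ι)|_U` is `𝟙 ⊗ ι|_V` (both are `Γ(U)`-linear and agree on `1 ⊗ m ↦ η(m)|_U`).
[cite: GortzWedhorn2020, Prop. 7.24 (2)] -/
theorem app_pullback_map_chartSectionsEquiv (hM' : IsAffineLocalizing M') (hM : IsAffineLocalizing M)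
    (q : chartTensor f M' hV i) :
    ((Scheme.Modules.pullback f).map ι).app U (chartSectionsEquiv f M' hV hU i hM' q) =
      chartSectionsEquiv f M hV hU i hM (chartTensorMap f ι hV i q) := by
  induction q using TensorProduct.induction_on with
  | zero => rw [map_zero, map_zero, map_zero, map_zero]
  | tmul c p =>
    obtain ⟨m, rfl⟩ := (appTopRestrictFromSpecEquiv M' hV).surjective p
    rw [chartTensorMap_tmul, restrictTopMap_apply, chartSectionsEquiv_tmul, chartSectionsEquiv_tmul,
      Scheme.Modules.Hom.app_smul, pullback_map_app_unitSectionLE]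
  | add q q' hq hq' => rw [map_add, map_add, hq, hq', map_add, map_add]

include hV hU in
/-- **The chart ring map `Γ(V, 𝒪_Y) → Γ(U, 𝒪_X)` of a flat morphism is flat** (`Flat` is the
affine-local property of `RingHom.Flat`; GW I Rem. 7.39: `Spec B → Spec A` is flat iff `B` is a flat
`A`-module). [cite: GortzWedhorn2020, Rem. 7.39] -/
theorem flat_chartHom [Flat f] : (chartHom f i).hom.Flat :=
  HasRingHomProperty.appLE @Flat f ‹Flat f› ⟨V, hV⟩ ⟨U, hU⟩ i

include hU in
/-- For `f` flat and `ι` a monomorphism, `𝟙 ⊗ ι|_V : Γ(U) ⊗ Γ(V, M') → Γ(U) ⊗ Γ(V, M)` is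
injective. [cite: GortzWedhorn2020, (7.18.1) after Rem. 7.39] -/
theorem chartTensorMap_injective [Flat f] [Mono ι] :
    Function.Injective (chartTensorMap f ι hV i) := by
  letI : Algebra Γ(Y, V) Γ(X, U) := ((algebraMap Γ(X, U) Γ(X, U)).comp (chartHom f i).hom).toAlgebra
  haveI : Module.Flat Γ(Y, V) Γ(X, U) := flat_chartHom f hV hU i
  exact Module.Flat.lTensor_preserves_injective_linearMap (M := Γ(X, U))
    (restrictTopMap ι hV).hom (restrictTopMap_injective ι hV)

include hV hU i in
/-- **`(f^*ι)|_U` is injective** for `f` flat, `ι : M' ↪ M` a monomorphism of affine-localizing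
modules, and affine `U ⊆ f⁻¹V`, `V` affine. [cite: GortzWedhorn2020, (7.18.1) after Rem. 7.39 with Prop. 7.24 (2)] -/
theorem pullback_map_app_injective_of_flat [Flat f] [Mono ι] (hM' : IsAffineLocalizing M')
    (hM : IsAffineLocalizing M) :
    Function.Injective (((Scheme.Modules.pullback f).map ι).app U) := by
  intro s t hst
  obtain ⟨q, rfl⟩ := (chartSectionsEquiv f M' hV hU i hM').surjective s
  obtain ⟨q', rfl⟩ := (chartSectionsEquiv f M' hV hU i hM').surjective t
  rw [app_pullback_map_chartSectionsEquiv f ι hV hU i hM' hM,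
    app_pullback_map_chartSectionsEquiv f ι hV hU i hM' hM] at hst
  rw [chartTensorMap_injective f ι hV hU i ((chartSectionsEquiv f M hV hU i hM).injective hst)]

end Chart

/-! ### `f^*` preserves monomorphisms of affine-localizing modules -/

/-- The affine opens of `X` mapping into an affine open of `Y` form a basis of `X` (affine opens form
a basis of `Y` and of every open of `X`). [cite: GortzWedhorn2020, Prop. 3.2 (affine open subschemes form a basis)] -/
theorem isBasis_affineOpens_le_preimage :
    Opens.IsBasis {U : X.Opens | IsAffineOpen U ∧ ∃ V : Y.Opens, IsAffineOpen V ∧ U ≤ f ⁻¹ᵁ V} := by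
  rw [Opens.isBasis_iff_nbhd]
  intro W x hx
  obtain ⟨V, hV, hxV, -⟩ := (Opens.isBasis_iff_nbhd.mp Y.isBasis_affineOpens)
    (show f.base x ∈ (⊤ : Y.Opens) from trivial)
  obtain ⟨U, hU, hxU, hUW⟩ := (Opens.isBasis_iff_nbhd.mp X.isBasis_affineOpens)
    (show x ∈ W ⊓ f ⁻¹ᵁ V from ⟨hx, hxV⟩)
  exact ⟨U, ⟨hU, V, hV, hUW.trans inf_le_right⟩, hxU, hUW.trans inf_le_left⟩

/-- **Flat pull-back preserves monomorphisms of quasi-coherent (affine-localizing) modules**: for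
`f : X → Y` flat and `ι : M' ↪ M` a monomorphism of affine-localizing `𝒪_Y`-modules, `f^*ι` is a
monomorphism. [cite: GortzWedhorn2020, (7.18.1) after Rem. 7.39 (`𝓕 = 𝒪_X`)]
[cite: Hartshorne1977, III §9 p. 254 with II Prop. 5.2 (e)] -/
theorem mono_pullback_map_of_flat [Flat f] {M' M : Y.Modules} (hM' : IsAffineLocalizing M')
    (hM : IsAffineLocalizing M) (ι : M' ⟶ M) [Mono ι] :
    Mono ((Scheme.Modules.pullback f).map ι) :=
  mono_of_injective_on_basis _ (isBasis_affineOpens_le_preimage f) fun U hU => by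
    obtain ⟨hU, V, hV, i⟩ := hU
    exact pullback_map_app_injective_of_flat f ι hV hU i hM' hM

/-- **Flat pull-back is exact on short exact sequences of quasi-coherent (affine-localizing)
modules**: for `f` flat and `0 → M' → M → M'' → 0` short exact with `M'`, `M` affine-localizing,
`0 → f^*M' → f^*M → f^*M'' → 0` is short exact. [cite: GortzWedhorn2020, (7.18.1) after Rem. 7.39 (`𝓕 = 𝒪_X`)]
[cite: Hartshorne1977, III §9 p. 254 with II Prop. 5.2 (e)] -/
theorem shortExact_map_pullback_of_flat [Flat f] {S : ShortComplex Y.Modules} (hS : S.ShortExact)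
    (h₁ : IsAffineLocalizing S.X₁) (h₂ : IsAffineLocalizing S.X₂) :
    (S.map (Scheme.Modules.pullback f)).ShortExact := by
  obtain ⟨hex, hepi⟩ := exact_map_pullback_and_epi f hS
  haveI : Epi (S.map (Scheme.Modules.pullback f)).g := hepi
  haveI : Mono S.f := hS.mono_f
  haveI : Mono (S.map (Scheme.Modules.pullback f)).f := mono_pullback_map_of_flat f h₁ h₂ S.f
  exact { exact := hex }

/-- The same for `M'`, `M` quasi-coherent in Mathlib's sense (`SheafOfModules.IsQuasicoherent`).
[cite: GortzWedhorn2020, (7.18.1) after Rem. 7.39 (`𝓕 = 𝒪_X`)] -/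
theorem shortExact_map_pullback_of_flat_of_isQuasicoherent [Flat f] {S : ShortComplex Y.Modules}
    (hS : S.ShortExact) [S.X₁.IsQuasicoherent] [S.X₂.IsQuasicoherent] :
    (S.map (Scheme.Modules.pullback f)).ShortExact :=
  shortExact_map_pullback_of_flat f hS (IsAffineLocalizing.of_isQuasicoherent _)
    (IsAffineLocalizing.of_isQuasicoherent _)

end Literature.AlgebraicGeometry.Modules

end
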